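import Literature.NumberTheory.LFunctions.WeilTwoPrimeDeflL2Base
import Literature.NumberTheory.LFunctions.WeilBlockRowsPZ
import HarnessLib

/-!
# Deflated two-prime certificate L2: the factored even inverse agrees with `D`, rows 72–79

`WeilCert.checkDnRow` (even block) for certificate L2, by `decide +kernel`. Pure proof file.
-/

noncomputable section

namespace Literature.NumberTheory.LFunctions

set_option maxHeartbeats 0 in
/-- Row 72 of `DnE/LsE` is row 72 of the even `D` (certificate L2). [folklore] -/
theorem checkDnRow0_72_weilCertDeflL2 : weilCertDeflL2Base.checkDnRow weilCertDeflL2DnE weilCertDeflL2LsE 0 72 = true := by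
  decide +kernel

set_option maxHeartbeats 0 in
/-- Row 73 of `DnE/LsE` is row 73 of the even `D` (certificate L2). [folklore] -/
theorem checkDnRow0_73_weilCertDeflL2 : weilCertDeflL2Base.checkDnRow weilCertDeflL2DnE weilCertDeflL2LsE 0 73 = true := by
  decide +kernel

set_option maxHeartbeats 0 in
/-- Row 74 of `DnE/LsE` is row 74 of the even `D` (certificate L2). [folklore] -/
theorem checkDnRow0_74_weilCertDeflL2 : weilCertDeflL2Base.checkDnRow weilCertDeflL2DnE weilCertDeflL2LsE 0 74 = true := by
  decide +kernel

set_option maxHeartbeats 0 in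
/-- Row 75 of `DnE/LsE` is row 75 of the even `D` (certificate L2). [folklore] -/
theorem checkDnRow0_75_weilCertDeflL2 : weilCertDeflL2Base.checkDnRow weilCertDeflL2DnE weilCertDeflL2LsE 0 75 = true := by
  decide +kernel

set_option maxHeartbeats 0 in
/-- Row 76 of `DnE/LsE` is row 76 of the even `D` (certificate L2). [folklore] -/
theorem checkDnRow0_76_weilCertDeflL2 : weilCertDeflL2Base.checkDnRow weilCertDeflL2DnE weilCertDeflL2LsE 0 76 = true := by
  decide +kernel

set_option maxHeartbeats 0 in
/-- Row 77 of `DnE/LsE` is row 77 of the even `D` (certificate L2). [folklore] -/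
theorem checkDnRow0_77_weilCertDeflL2 : weilCertDeflL2Base.checkDnRow weilCertDeflL2DnE weilCertDeflL2LsE 0 77 = true := by
  decide +kernel

set_option maxHeartbeats 0 in
/-- Row 78 of `DnE/LsE` is row 78 of the even `D` (certificate L2). [folklore] -/
theorem checkDnRow0_78_weilCertDeflL2 : weilCertDeflL2Base.checkDnRow weilCertDeflL2DnE weilCertDeflL2LsE 0 78 = true := by
  decide +kernel

set_option maxHeartbeats 0 in
/-- Row 79 of `DnE/LsE` is row 79 of the even `D` (certificate L2). [folklore] -/
theorem checkDnRow0_79_weilCertDeflL2 : weilCertDeflL2Base.checkDnRow weilCertDeflL2DnE weilCertDeflL2LsE 0 79 = true := by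
  decide +kernel


end Literature.NumberTheory.LFunctions
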